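import Mathlib
import Summits.Ventures.PercRepro2.Defs
import Summits.Ventures.PercRepro2.Graph
import Summits.Ventures.PercRepro2.Events
import Summits.Ventures.PercRepro2.Harris
import Summits.Ventures.PercRepro2.Induced
import Summits.Ventures.PercRepro2.BHKEvents
import Summits.Ventures.PercRepro2.BHKAvoid

/-!
# The case-mean inequality (b) of the (J1) line (blind cell PercRepro2, mine-1)

Five marks `o, a₁, a₂, a₃` (and `b`, absent here) on a finite graph; `C₁, C₂` the open clusters of
`a₁, a₂`, `U = C₁ ∪ C₂`, `Q = {a₁ ↮ a₂}`, `γ = P(o ∈ U | Q, a₃ ∉ U)`.  The statement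

  **(b)**  `P(o ∈ C₂ | a₃ ∈ C₁, Q) ≤ γ`,

multiplied out (`jOneB`): `P(o ∈ C₂, a₃ ∈ C₁, Q) · P(a₃ ∉ U, Q) ≤ P(a₃ ∈ C₁, Q) · P(o ∈ U, a₃ ∉ U, Q)`.

It is the sign `η̄₁ ≥ 0` of the case-1 mean of `H = σ₃ (γ − Y)` in the host-cluster decomposition
of the cross term (J1) of (HCOV); with its `a₁ ↔ a₂` mirror and the two BHK signs of `β̄₁ − β̄`,
`β̄₂ − β̄` it makes the between-case part of (J1-K) a theorem.

Proof: with `s = a₂`, `t = a₁`, `X = {a₁, a₃}`, `𝓤 = {S ∋ o}`, `𝓥 = {S ∋ a₃}`, the cross-cluster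
inequality with set avoidance (`bhk_cross_cluster_avoid`, BHK06 Thm 1.4) reads
`A · Dx ≤ B · C` with `A = P(o ∈ C₂, a₃ ∈ C₁, a₂ ↮ {a₁, a₃})`, `Dx = P(a₂ ↮ {a₁, a₃})`,
`B = P(o ∈ C₂, a₂ ↮ {a₁, a₃})`, `C = P(a₃ ∈ C₁, a₂ ↮ {a₁, a₃})`.  Since `a₃ ∈ C₁` and `a₁ ↮ a₂`
force `a₂ ↮ a₃`, `A` and `C` are the two left factors of (b); `Dx = C + D` with
`D = P(a₃ ∉ U, Q)` and `B = A + A'` with `A' = P(o ∈ C₂, a₃ ∉ U, Q) ≤ P(o ∈ U, a₃ ∉ U, Q)`;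
hence `A · D = A · Dx − A · C ≤ (B − A) · C = A' · C ≤ P(o ∈ U, a₃ ∉ U, Q) · C`.
-/

namespace Summit.Ventures.PercRepro2

section JOneB

variable {V : Type*} {E : Type*} [Fintype E] [DecidableEq E] [Fintype V] [DecidableEq V]
  {R : Type*} [CommRing R] [LinearOrder R] [IsStrictOrderedRing R]

omit [Fintype E] [DecidableEq E] [Fintype V] [DecidableEq V] in
/-- `{C(x) ∋ v}` is the connection event `{x ↔ v}`. -/
lemma jOneB_clusterInEvent_mem (ends : E → Sym2 V) (x v : V) :
    clusterInEvent ends x {S : Set V | v ∈ S} = connEvent ends x v := by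
  ext ω
  simp [clusterInEvent, connEvent]

omit [Fintype E] [DecidableEq E] [Fintype V] [DecidableEq V] in
/-- `{S | v ∈ S}` is an up-set of vertex sets. -/
lemma jOneB_isUpperSet_mem (v : V) : IsUpperSet {S : Set V | v ∈ S} :=
  fun _ _ h hv => h hv

omit [Fintype E] [DecidableEq E] [Fintype V] in
/-- `{s ↮ x, s ↮ y}` as an intersection of two non-connection events. -/
lemma jOneB_avoidAll_pair (ends : E → Sym2 V) (s x y : V) :
    avoidAll ends s {x, y} = (connEvent ends s x)ᶜ ∩ (connEvent ends s y)ᶜ := by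
  ext ω
  simp [avoidAll, connEvent]

omit [Fintype E] [DecidableEq E] [Fintype V] [DecidableEq V] in
/-- If `a₁ ↔ a₃` and `a₁ ↮ a₂` then `a₂ ↮ a₃`. -/
lemma jOneB_not_conn_of_conn {ends : E → Sym2 V} {ω : Config E} {a₁ a₂ a₃ : V}
    (h13 : Conn ends ω a₁ a₃) (h12 : ¬ Conn ends ω a₁ a₂) : ¬ Conn ends ω a₂ a₃ :=
  fun h23 => h12 (conn_trans h13 (conn_symm h23))

/-- **(b), multiplied out**: `P(o ∈ C₂, a₃ ∈ C₁, Q) · P(a₃ ∉ U, Q) ≤ P(a₃ ∈ C₁, Q) · P(o ∈ U, a₃ ∉ U, Q)`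
with `Q = {a₁ ↮ a₂}` and `U = C₁ ∪ C₂`; i.e. `P(o ∈ C₂ | a₃ ∈ C₁, Q) ≤ P(o ∈ U | a₃ ∉ U, Q) = γ`. -/
theorem jOneB (p : E → R) (hp : IsProbVec p) (ends : E → Sym2 V) (o a₁ a₂ a₃ : V) :
    prob p (connEvent ends a₂ o ∩ connEvent ends a₁ a₃ ∩ (connEvent ends a₁ a₂)ᶜ) *
        prob p ((connEvent ends a₁ a₃)ᶜ ∩ (connEvent ends a₂ a₃)ᶜ ∩ (connEvent ends a₁ a₂)ᶜ) ≤
      prob p (connEvent ends a₁ a₃ ∩ (connEvent ends a₁ a₂)ᶜ) *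
        prob p ((connEvent ends a₁ o ∪ connEvent ends a₂ o) ∩ (connEvent ends a₁ a₃)ᶜ ∩
          (connEvent ends a₂ a₃)ᶜ ∩ (connEvent ends a₁ a₂)ᶜ) := by
  classical
  -- the avoidance event `{a₂ ↮ a₁, a₂ ↮ a₃}` and the cross-cluster inequality
  have key := bhk_cross_cluster_avoid p hp ends a₂ a₁ (X := {a₁, a₃}) (by simp)
    (jOneB_isUpperSet_mem (V := V) o) (jOneB_isUpperSet_mem (V := V) a₃)
  rw [jOneB_clusterInEvent_mem, jOneB_clusterInEvent_mem, jOneB_avoidAll_pair,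
    connEvent_comm ends a₂ a₁] at key
  set Q := (connEvent ends a₁ a₂)ᶜ with hQ
  set Ax := Q ∩ (connEvent ends a₂ a₃)ᶜ with hAx
  -- on `{a₁ ↔ a₃} ∩ Q` the avoidance of `a₃` by `a₂` is automatic
  have e1 : connEvent ends a₂ o ∩ connEvent ends a₁ a₃ ∩ Ax =
      connEvent ends a₂ o ∩ connEvent ends a₁ a₃ ∩ Q := by
    ext ω
    simp only [hAx, hQ, Set.mem_inter_iff, Set.mem_compl_iff, mem_connEvent]
    constructor
    · rintro ⟨⟨ho, h13⟩, h12, _⟩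
      exact ⟨⟨ho, h13⟩, h12⟩
    · rintro ⟨⟨ho, h13⟩, h12⟩
      exact ⟨⟨ho, h13⟩, h12, jOneB_not_conn_of_conn h13 h12⟩
  have e2 : connEvent ends a₁ a₃ ∩ Ax = connEvent ends a₁ a₃ ∩ Q := by
    ext ω
    simp only [hAx, hQ, Set.mem_inter_iff, Set.mem_compl_iff, mem_connEvent]
    constructor
    · rintro ⟨h13, h12, _⟩
      exact ⟨h13, h12⟩
    · rintro ⟨h13, h12⟩
      exact ⟨h13, h12, jOneB_not_conn_of_conn h13 h12⟩
  rw [e1, e2] at key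
  -- `Dx = C + D`: split the avoidance event by `{a₁ ↔ a₃}`
  have hDx := prob_inter_add_prob_inter_compl p Ax (connEvent ends a₁ a₃)
  have e3 : Ax ∩ connEvent ends a₁ a₃ = connEvent ends a₁ a₃ ∩ Q := by
    rw [Set.inter_comm, e2]
  have e4 : Ax ∩ (connEvent ends a₁ a₃)ᶜ =
      (connEvent ends a₁ a₃)ᶜ ∩ (connEvent ends a₂ a₃)ᶜ ∩ Q := by
    ext ω
    simp only [hAx, Set.mem_inter_iff, Set.mem_compl_iff, mem_connEvent]
    tauto
  rw [e3, e4] at hDx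
  -- `B = A + A'`: split `{o ∈ C₂} ∩ Ax` by `{a₁ ↔ a₃}`
  have hB := prob_inter_add_prob_inter_compl p (connEvent ends a₂ o ∩ Ax) (connEvent ends a₁ a₃)
  have e5 : connEvent ends a₂ o ∩ Ax ∩ connEvent ends a₁ a₃ =
      connEvent ends a₂ o ∩ connEvent ends a₁ a₃ ∩ Q := by
    rw [← e1]
    ext ω
    simp only [Set.mem_inter_iff]
    tauto
  rw [e5] at hB
  -- `A' ≤ P(o ∈ U, a₃ ∉ U, Q)`
  have hA' : prob p (connEvent ends a₂ o ∩ Ax ∩ (connEvent ends a₁ a₃)ᶜ) ≤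
      prob p ((connEvent ends a₁ o ∪ connEvent ends a₂ o) ∩ (connEvent ends a₁ a₃)ᶜ ∩
        (connEvent ends a₂ a₃)ᶜ ∩ Q) := by
    refine prob_mono hp ?_
    intro ω hω
    simp only [hAx, Set.mem_inter_iff, Set.mem_compl_iff, mem_connEvent, Set.mem_union] at hω ⊢
    tauto
  have hC0 : 0 ≤ prob p (connEvent ends a₁ a₃ ∩ Q) := prob_nonneg hp _
  have hA0 : 0 ≤ prob p (connEvent ends a₂ o ∩ connEvent ends a₁ a₃ ∩ Q) := prob_nonneg hp _
  nlinarith [key, hDx, hB, hA', hC0, hA0]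

end JOneB

end Summit.Ventures.PercRepro2
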